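import Summits.CriticalPhenomena.PercolationContinuityZ3.Theorems.PercNearOneGluingNoHeavyQuantLightPairBlobForest
import Summits.CriticalPhenomena.PercolationContinuityZ3.Theorems.PercNearOneGluingNoHeavyQuantGluedPairHull
import HarnessLib

/-!
# QUANT lane R8, T-DEC: THE LIGHT GLUED PAIR WITH A LIGHT-ROOT SIBLING (`q(1+cs) ≤ 1`) IS IN THE BLOB HULL, hence in the gated
# caterpillar hull — lead g46's single-sibling criterion `inBlobHull_gluedPair_of_le` joined with itself (`InBlobHull.lconv`)

builds on p205010 (kernel theorem, internal audit signed; external expert review pending)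

Support file (`--supports stmt-CriticalPhenomena-4575`), QUANT lane census seat prim-quant-census-2 (gen 77), rung R8 of
`run/shared/lean/prim/quant/LADDER.md`.  Theorems only; standard axioms, no sorries.  A twelve-line corollary recorded so that the
covered region of the family `lpT c q s = (R¹[q](R^c[s]))²` (census-2 g76/g77: `…QuantLightPairCatHull*`, `…QuantCatHullSmallGates`,
`…QuantLightPairBlobForest*`) is stated by name in one place more: the band `T = 2q(1+cs) ≤ 2`.

WHAT.  Lead g46 (✓ `…QuantGluedPairHull`): a single glued sibling `R^a[q](R^b[s])` with a LIGHT ROOT, `q(a + bs) ≤ a`, lies in the blob hull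
`K_x(q(a+bs))` at every floor `x ≤ qs` (two blob forests).  Typer g40 (✓ `…QuantJointBlobHull`): the blob hull is closed under independent
joins (`InBlobHull.lconv`) and sits inside the gated caterpillar hull (`inGatedCatHull_of_inBlobHull`, typer g41).  Hence for `a = 1`, `b = c`:
* **`lpT_inBlobHull_lightRoot`**: `1 ≤ c`, `0 < q`, `0 < s ≤ 1`, `q(1+cs) ≤ 1` ⟹ `InBlobHull x (2q(1+cs)) (2c+2) (lpT c q s)` for every `0 < x ≤ qs`;
* **`lpT_inGatedCatHull_lightRoot`** (same hypotheses, `s < 1`), `sdec_lpT_lightRoot`, **`treeBuiltCatHull_lpT_lightRoot`** (the light node on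
  every tree-built presentation at a floor `≤ qs`).
The band `q(1+cs) ≤ 1` (`T ≤ 2`) is the far-left strip of the light region (small `s` at any root gate `q < 1`, e.g. `c = 4`: `q = .8, s ≤ 1/16`;
`q = .6, s ≤ 1/6`); it overlaps p490773's `q ≤ 1/2` and is disjoint from the blob-forest patterns `M`/`H` of `…QuantLightPairBlobForest*` (which
need `2(1−q) ≤ cqs`, i.e. `T ≥ 2`), so the three together make the covered region connected along the `s → 0` edge.
HONEST STATUS.  Instances on an explicit region only; `TreeBuiltCatHullLight`, `CatPairLight`, `SiblingStep`, `FarTreeRow` remain OPEN; RATE class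
log\* / honest sentence of `run/shared/lean/prim/quant/README.md` unchanged.  [this work]; criterion: prim-quant-lead g46; blob hull: prim-quant-stmt
g40.  Nothing here is cited as a published result.  The gluing rows served [cite: KozmaNitzan2024, Conjecture 3 (p. 15)]; product measure
[cite: Grimmett1999, §1.3 p. 10].
-/

noncomputable section

open scoped BigOperators

namespace Summit.CriticalPhenomena.PercolationContinuityZ3.Theorems
namespace Quant
namespace LawDec

open Finset

/-- **LIGHT ROOT ⟹ THE PAIR IS IN THE BLOB HULL**: `q(1+cs) ≤ 1` ⟹ `lpT c q s ∈ K_x(2q(1+cs))`, top `2c+2`, at every floor `0 < x ≤ qs`.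
[this work] -/
theorem lpT_inBlobHull_lightRoot (c : ℕ) (q s : ℝ) (hc : 1 ≤ c) (hq0 : 0 < q) (hs0 : 0 < s) (hs1 : s ≤ 1)
    (hle : q * (1 + c * s) ≤ 1) (x : ℝ) (hx0 : 0 < x) (hxs : x ≤ q * s) :
    InBlobHull x (2 * q * (1 + c * s)) (2 * c + 2) (lpT c q s) := by
  have h1 := inBlobHull_gluedPair_of_le x q s 1 c le_rfl hc hx0 hxs hq0 hs0.le hs1 (by push_cast; linarith)
  have h2 := InBlobHull.lconv h1 h1
  have e : q * (((1 : ℕ) : ℝ) + (c : ℝ) * s) + q * (((1 : ℕ) : ℝ) + (c : ℝ) * s) = 2 * q * (1 + c * s) := by push_cast; ring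
  rw [e, Nat.add_comm 1 c] at h2
  exact h2.mono le_rfl (by omega)

/-- **… hence in the gated caterpillar hull** (`s < 1`, so the floor `x ≤ qs < 1`). [this work] -/
theorem lpT_inGatedCatHull_lightRoot (c : ℕ) (q s : ℝ) (hc : 1 ≤ c) (hq0 : 0 < q) (hs0 : 0 < s) (hs1 : s < 1)
    (hle : q * (1 + c * s) ≤ 1) (x : ℝ) (hx0 : 0 < x) (hxs : x ≤ q * s) :
    InGatedCatHull x (2 * q * (1 + c * s)) (2 * c + 2) (lpT c q s) := by
  have hq1 : q ≤ 1 := by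
    have : 0 ≤ q * (c * s) := by positivity
    nlinarith
  have hx1 : x < 1 := by nlinarith
  exact inGatedCatHull_of_inBlobHull (lpT_inBlobHull_lightRoot c q s hc hq0 hs0 hs1.le hle x hx0 hxs) hx0 hx1

/-- **SDEC at the natural floor** in the light-root band. [this work] -/
theorem sdec_lpT_lightRoot (c : ℕ) (q s : ℝ) (hc : 1 ≤ c) (hq0 : 0 < q) (hs0 : 0 < s) (hs1 : s < 1) (hle : q * (1 + c * s) ≤ 1) :
    SDEC (q * s) (2 * c + 2) (lpT c q s) :=
  sdec_of_inGatedCatHull (mul_pos hq0 hs0) (lpT_inGatedCatHull_lightRoot c q s hc hq0 hs0 hs1 hle (q * s) (mul_pos hq0 hs0) le_rfl)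

/-- **THE LIGHT NODE ON THESE LAWS**: every tree-built presentation `TreeBuilt x M T` at a floor `x ≤ qs` is in the hull at `x`, its own mean and
its own top. [this work] -/
theorem treeBuiltCatHull_lpT_lightRoot (c : ℕ) (q s : ℝ) (hc : 1 ≤ c) (hq0 : 0 < q) (hs0 : 0 < s) (hs1 : s < 1)
    (hle : q * (1 + c * s) ≤ 1) (x : ℝ) (M : ℕ) (hTB : TreeBuilt x M (lpT c q s)) (hx : x ≤ q * s) :
    InGatedCatHull x (∑ h ∈ Finset.range (M + 1), (h : ℝ) * lpT c q s h) M (lpT c q s) := by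
  have hq1 : q ≤ 1 := by
    have : 0 ≤ q * (c * s) := by positivity
    nlinarith
  obtain ⟨hx0, hM⟩ := lpT_treeBuilt_top c q s hq0 hq1 hs0 hs1.le hTB
  obtain ⟨a, rfl⟩ := Nat.exists_eq_add_of_le hM
  rw [sum_range_extend (fun h => (h : ℝ) * lpT c q s h) (2 * c + 2) a (fun h hh => by rw [lpT_eq_zero c q s h hh, mul_zero]),
    lpT_mean]
  exact (lpT_inGatedCatHull_lightRoot c q s hc hq0 hs0 hs1 hle x hx0 hx).mono_top hM

end LawDec
end Quant
end Summit.CriticalPhenomena.PercolationContinuityZ3.Theorems
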